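import Literature.NumberTheory.Transcendental.SixExponentialsSeveralVariables
import Literature.NumberTheory.Transcendental.SixExponentialsSeveralVariablesExtremal
import Literature.NumberTheory.Transcendental.SixExponentialsSeveralVariablesProofs
import Mathlib.LinearAlgebra.Basis.VectorSpace
import HarnessLib

/-!
# Waldschmidt 1981: Théorème 1.1 from Proposition 6.1 (proof of §6 a))

Topic `Literature/NumberTheory/Transcendental`; sibling proof file of
`SixExponentialsSeveralVariables.lean` (the named facts `Waldschmidt1981.thm_1_1`, `thm_2_1` of
[Waldschmidt1981]) and of `SixExponentialsSeveralVariablesSteps.lean` (the named facts of §§3–6,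
among them **Proposition 6.1**, `Waldschmidt1981.prop_6_1`: "Si `d > n`, alors
`μ(Y) ≤ d/(d − n)`"). It proves, sorry-free, the printed deduction [Waldschmidt1981, §6 a),
pp. 109–110] of the several-variable six exponentials theorem from Proposition 6.1:

`thm_1_1_of_prop_6_1 : prop_6_1 → thm_1_1`,

and records the composite with the tree's `thm_2_1_of_thm_1_1` (§6 c)):
`thm_2_1_of_prop_6_1 : prop_6_1 → thm_2_1`.

So the un-discharged input below Théorème 1.1, Théorème 2.1 and Roy's quotation of the latter
(`Literature.Barriers.Schanuel.waldschmidt1981_linearSubgroup_matrix`) is now exactly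
Proposition 6.1, i.e. (pp. 106–109 of the source) Lemmes 5.2–5.4 (pure algebra) and
Corollaire 4.2 — the auxiliary function of Corollaire 3.2, Masser's zero estimate (Théorème 4.1)
and Liouville's inequality.

## The printed proof (p. 109, l. −3 to p. 110, l. 12) and its rendering

> "Sous les hypothèses du théorème 1.1, on déduit de la proposition 6.1 l'inégalité
> `μ(X) < d/n`. D'après le lemme 5.1, il existe un sous-espace `W` de `ℂⁿ`, de dimension `n₁`,
> et un sous-groupe `X₁` de `X ∩ W`, de rang `d₁` tels que `μ(X₁, W) = d₁/n₁ > d/n`. On peut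
> évidemment choisir un tel `X₁` qui soit facteur direct dans `X`, et on note `X = X₁ ⊕ X₂` …
> On note `V` l'orthogonal de `W`, `Y₂ = Y ∩ V`, et `ℓ₂` le rang de `Y₂`. On a `Y = Y₁ ⊕ Y₂`, où
> `Y₁` est de rang `ℓ₁ = ℓ − ℓ₂`. On identifie `ℂⁿ/V` à `W`, et on note `s : ℂⁿ → ℂⁿ/V` la
> surjection canonique. Alors `rang_ℤ s(Y) = ℓ − rang_ℤ Y ∩ V = ℓ₁`. Comme
> `exp⟨s(Y), X₁⟩ ⊂ ℚ̄` et que `μ(X₁) = d₁/n₁`, on déduit de la proposition 6.1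
> `ℓ₁d₁ ≤ n₁(ℓ₁ + d₁)`, d'où le théorème 1.1."

* "`μ(X) < d/n`": Proposition 6.1 with the roles of `X` and `Y` exchanged (the pairing
  `⟨u, v⟩ = ∑ uₖvₖ` is symmetric): `ℓ > n` gives `μ(X) ≤ ℓ/(ℓ − n)`, and `ℓd > n(ℓ + d)` is
  `ℓ/(ℓ − n) < d/n`.
* Lemme 5.1 and "facteur direct": the slope-maximal subspace `W` of
  `exists_extremal_subspace` (`SixExponentialsSeveralVariablesExtremal.lean`) with
  `X₁ = X ∩ W`, which is saturated in `X`, hence a direct factor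
  (`exists_compl_of_saturated`, `SixExponentialsSeveralVariablesLattice.lean`); `span_ℂ X₁ = W`
  (`span_inf_eq_of_slope_maximal`), so `n₁ = dim_ℂ span X₁` as in the statement.
* `V`, `s`: for a basis `(wₖ)` of `W`, `s z = (⟨wₖ, z⟩)ₖ : ℂⁿ → ℂ^{n₁}` and `V = ker s = W^⊥`;
  `Y₂ = Y ∩ V` is saturated, `Y = Y₁ ⊕ Y₂`; `⟨X₁, Y₂⟩ = 0` (`dotProduct_eq_zero_of_mem_ker`).
* the last step: if `ℓ₁ ≤ n₁` the inequality is trivial; if `ℓ₁ > n₁`, Proposition 6.1 in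
  `ℂ^{n₁}` for the families `s(b₁ⱼ)` (`b₁` a `ℤ`-basis of `Y₁`; `s` is injective on `Y₁` because
  `Y₁ ∩ V ⊆ Y₁ ∩ Y₂ = 0`, so these are `ℓ₁` independent vectors spanning `s(Y) = s(Y₁)`) and
  `P(bᵢ)` (`b` a `ℤ`-basis of `X₁`, `P` the coordinates in the basis `(wₖ)`, so that
  `⟨x, z⟩ = P x ⬝ s z` for `x ∈ W` and `exp(P bᵢ ⬝ s b₁ⱼ) = exp⟨bᵢ, b₁ⱼ⟩ ∈ ℚ̄`) gives
  `μ(P X₁) ≤ ℓ₁/(ℓ₁ − n₁)`, while slope-maximality read in coordinates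
  (`not_mu_map_lt_of_slope_maximal`, "`μ(X₁) = d₁/n₁`") gives `μ(P X₁) ≥ d₁/n₁`; hence
  `d₁(ℓ₁ − n₁) ≤ n₁ℓ₁`, i.e. `ℓ₁d₁ ≤ n₁(ℓ₁ + d₁)`.

## References

* [Waldschmidt1981] M. Waldschmidt, *Transcendance et exponentielles en plusieurs variables*,
  Invent. Math. 63 (1981) 97–127, doi:10.1007/bf01389195, §6 a) "Démonstration du théorème 1.1"
  (pp. 109–110); §5 a) Lemme 5.1 (p. 106). Open scan: GDZ PPN356556735_0063, LOG_0012.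
-/

noncomputable section

open Complex Matrix Module

namespace Literature.NumberTheory.Transcendental.Waldschmidt1981

/-! ### Small lemmas -/

/-- A `ℤ`-linearly independent family of `d > n` vectors cannot live in `ℂ⁰`: the numerical
hypothesis of Théorème 1.1 forces `n ≥ 1`. [folklore] -/
theorem pos_of_linearIndependent_of_lt {n d : ℕ} {x : Fin d → Fin n → ℂ}
    (hx : LinearIndependent ℤ x) (hnd : n < d) : 0 < n := by
  rcases Nat.eq_zero_or_pos n with h0 | h0
  · subst h0
    exfalso
    have hd : 0 < d := lt_of_le_of_lt (Nat.zero_le _) hnd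
    have : x ⟨0, hd⟩ = 0 := Subsingleton.elim _ _
    exact hx.ne_zero ⟨0, hd⟩ this
  · exact h0

/-- The numerology `ℓd > n(ℓ + d)` of Théorème 1.1 in the form `ℓ/(ℓ − n) < d/n` used with
Proposition 6.1 ("on déduit de la proposition 6.1 l'inégalité `μ(X) < d/n`").
[cite: Waldschmidt1981, §6 a) (p. 109)] -/
theorem div_sub_lt_div_of_mul_add_lt {n d l : ℕ} (h : n * (l + d) < l * d) (hn : 0 < n)
    (hnl : n < l) : (l : ℚ) / (l - n) < d / n := by
  have hln : (0 : ℚ) < (l : ℚ) - n := by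
    have : (n : ℚ) < l := by exact_mod_cast hnl
    linarith
  have hn' : (0 : ℚ) < n := by exact_mod_cast hn
  rw [div_lt_div_iff₀ hln hn']
  have h' : (n : ℚ) * (l + d) < l * d := by exact_mod_cast h
  nlinarith

/-- From `d₁/n₁ ≤ ℓ₁/(ℓ₁ − n₁)` (`ℓ₁ > n₁ > 0`) to the printed `ℓ₁d₁ ≤ n₁(ℓ₁ + d₁)`.
[cite: Waldschmidt1981, §6 a) (p. 110)] -/
theorem mul_le_mul_add_of_div_le_div {n₁ d₁ l₁ : ℕ} (hn₁ : 0 < n₁) (hl : n₁ < l₁)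
    (h : (d₁ : ℚ) / n₁ ≤ (l₁ : ℚ) / (l₁ - n₁)) : l₁ * d₁ ≤ n₁ * (l₁ + d₁) := by
  have hln : (0 : ℚ) < (l₁ : ℚ) - n₁ := by
    have : (n₁ : ℚ) < l₁ := by exact_mod_cast hl
    linarith
  have hn' : (0 : ℚ) < n₁ := by exact_mod_cast hn₁
  rw [div_le_div_iff₀ hn' hln] at h
  have h' : (l₁ : ℚ) * d₁ ≤ n₁ * (l₁ + d₁) := by nlinarith
  exact_mod_cast h'

/-! ### Coordinates on a subspace `W` and the dual map `s` -/

section Coordinates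

variable {n m : ℕ}

/-- The rows of the matrix `(wₖ)` built from a basis of the subspace `W ⊆ ℂⁿ` (so that
`w.mulVecLin z = (⟨wₖ, z⟩)ₖ` is the map `s : ℂⁿ → ℂⁿ/V ≅ ℂ^{n₁}` of the source) are the basis
vectors. [cite: Waldschmidt1981, §6 a) (p. 110)] -/
theorem row_of_basis (W : Submodule ℂ (Fin n → ℂ)) (b : Basis (Fin m) ℂ W) :
    (Matrix.of fun k => ((b k : W) : Fin n → ℂ)).row = fun k => ((b k : W) : Fin n → ℂ) := by
  funext k
  ext j
  simp [Matrix.row]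

/-- The rows `(wₖ)` are linearly independent. [folklore] -/
theorem linearIndependent_row_of_basis (W : Submodule ℂ (Fin n → ℂ)) (b : Basis (Fin m) ℂ W) :
    LinearIndependent ℂ (Matrix.of fun k => ((b k : W) : Fin n → ℂ)).row := by
  rw [row_of_basis]
  exact b.linearIndependent.map' W.subtype (Submodule.ker_subtype W)

/-- The rows `(wₖ)` span `W`. [folklore] -/
theorem span_row_of_basis (W : Submodule ℂ (Fin n → ℂ)) (b : Basis (Fin m) ℂ W) :
    Submodule.span ℂ (Set.range (Matrix.of fun k => ((b k : W) : Fin n → ℂ)).row) = W := by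
  rw [row_of_basis]
  exact span_range_coe_basis b

/-- `s z = (⟨wₖ, z⟩)ₖ`. [cite: Waldschmidt1981, §6 a) (p. 110)] -/
theorem of_basis_mulVecLin_apply (W : Submodule ℂ (Fin n → ℂ)) (b : Basis (Fin m) ℂ W)
    (z : Fin n → ℂ) (k : Fin m) :
    (Matrix.of fun k => ((b k : W) : Fin n → ℂ)).mulVecLin z k = ((b k : W) : Fin n → ℂ) ⬝ᵥ z := by
  simp [Matrix.mulVec]

/-- **Coordinates on `W`.** For a basis `(wₖ)_{k < m}` of `W`, a `ℂ`-linear `P : ℂⁿ → ℂ^m`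
which on `W` is the coordinate map in this basis — injective on `W`, onto from `W` — and such
that `⟨x, z⟩ = P x ⬝ s z` for `x ∈ W`, `z ∈ ℂⁿ`, where `s z = (⟨wₖ, z⟩)ₖ` ("On identifie
`ℂⁿ/V` à `W`"). [cite: Waldschmidt1981, §6 a) (p. 110)] -/
theorem exists_coordinates (W : Submodule ℂ (Fin n → ℂ)) (b : Basis (Fin m) ℂ W) :
    ∃ P : (Fin n → ℂ) →ₗ[ℂ] (Fin m → ℂ),
      (∀ u ∈ W, P u = 0 → u = 0) ∧ (∀ c, ∃ u ∈ W, P u = c) ∧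
      ∀ u ∈ W, ∀ z : Fin n → ℂ,
        u ⬝ᵥ z = P u ⬝ᵥ (Matrix.of fun k => ((b k : W) : Fin n → ℂ)).mulVecLin z := by
  classical
  obtain ⟨q, hq⟩ := W.exists_isCompl
  let π : (Fin n → ℂ) →ₗ[ℂ] W := Submodule.projectionOnto W q hq
  let P : (Fin n → ℂ) →ₗ[ℂ] (Fin m → ℂ) := b.equivFun.toLinearMap ∘ₗ π
  have hPW : ∀ u (hu : u ∈ W), P u = b.equivFun ⟨u, hu⟩ := by
    intro u hu
    have : π u = ⟨u, hu⟩ := Submodule.projectionOnto_apply_of_mem_left hq hu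
    simp only [P, LinearMap.coe_comp, LinearEquiv.coe_coe, Function.comp_apply, this]
  refine ⟨P, ?_, ?_, ?_⟩
  · intro u hu hPu
    rw [hPW u hu] at hPu
    have h0 : (⟨u, hu⟩ : W) = 0 := by
      have := congrArg b.equivFun.symm hPu
      rwa [LinearEquiv.symm_apply_apply, map_zero] at this
    exact congrArg Subtype.val h0
  · intro c
    refine ⟨(b.equivFun.symm c : W), (b.equivFun.symm c).2, ?_⟩
    rw [hPW _ (b.equivFun.symm c).2]
    exact b.equivFun.apply_symm_apply c
  · intro u hu z
    have hsum : (∑ k, b.equivFun ⟨u, hu⟩ k • b k) = (⟨u, hu⟩ : W) := b.sum_equivFun ⟨u, hu⟩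
    have hsumE : (∑ k, b.equivFun ⟨u, hu⟩ k • ((b k : W) : Fin n → ℂ)) = u := by
      have := congrArg (fun v : W => (v : Fin n → ℂ)) hsum
      simp only [Submodule.coe_sum, Submodule.coe_smul] at this
      exact this
    conv_lhs => rw [← hsumE]
    rw [sum_dotProduct, hPW u hu, dotProduct]
    refine Finset.sum_congr rfl fun k _ => ?_
    rw [smul_dotProduct, of_basis_mulVecLin_apply, smul_eq_mul]

end Coordinates

/-! ### Théorème 1.1 from Proposition 6.1 -/

/-- **Théorème 1.1 from Proposition 6.1** (the proof of §6 a) of the source, pp. 109–110).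
Under the hypotheses of Théorème 1.1: Proposition 6.1 (roles of `X`, `Y` exchanged) gives
`μ(X) ≤ ℓ/(ℓ − n) < d/n`; the slope-maximal subspace `W` (Lemme 5.1) gives the saturated
`X₁ = X ∩ W` with `d₁/n₁ > d/n`, `span X₁ = W`, a direct factor of `X`; `V = W^⊥ = ker s`,
`Y₂ = Y ∩ V` a direct factor of `Y`, `⟨X₁, Y₂⟩ = 0`; and Proposition 6.1 in `W ≅ ℂ^{n₁}` for
`s(Y₁)` (rank `ℓ₁`) and `X₁` ("`exp⟨s(Y), X₁⟩ ⊂ ℚ̄` et `μ(X₁) = d₁/n₁`") gives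
`ℓ₁d₁ ≤ n₁(ℓ₁ + d₁)`. [cite: Waldschmidt1981, §6 a) (pp. 109–110)] -/
theorem thm_1_1_of_prop_6_1 (h61 : prop_6_1) : thm_1_1 := by
  intro n d l x y hx hy hnum halg
  classical
  obtain ⟨hnd, hnl⟩ := lt_of_mul_add_lt hnum
  have hn : 0 < n := pos_of_linearIndependent_of_lt hx hnd
  set X : Submodule ℤ (Fin n → ℂ) := Submodule.span ℤ (Set.range x) with hXdef
  set Y : Submodule ℤ (Fin n → ℂ) := Submodule.span ℤ (Set.range y) with hYdef
  have hXfg : X.FG := Submodule.fg_span (Set.finite_range x)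
  have hYfg : Y.FG := Submodule.fg_span (Set.finite_range y)
  have hdX : finrank ℤ X = d := by
    rw [hXdef, finrank_span_eq_card hx, Fintype.card_fin]
  have hnE : finrank ℂ (Fin n → ℂ) = n := Module.finrank_fin_fun ℂ
  -- Step 1: `μ(X) ≤ ℓ/(ℓ - n) < d/n` (Proposition 6.1 with the roles of `X` and `Y` exchanged)
  have halg' : ∀ j i, IsAlgebraic ℚ (cexp (y j ⬝ᵥ x i)) := fun j i => by
    rw [dotProduct_comm]; exact halg i j
  have hmuX : mu ℂ X ≤ (l : ℚ) / (l - n) := h61 y x hy hx halg' hnl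
  have hmuX' : mu ℂ X < (finrank ℤ X : ℚ) / finrank ℂ (Fin n → ℂ) := by
    rw [hdX, hnE]
    exact lt_of_le_of_lt hmuX (div_sub_lt_div_of_mul_add_lt hnum hn hnl)
  -- Step 2: the extremal subspace `W` (Lemme 5.1), `X₁ = X ∩ W`
  obtain ⟨W, hWpos, hslope, hmax⟩ :=
    exists_extremal_subspace (K := ℂ) X hXfg (by rw [hnE]; exact hn) hmuX'
  rw [hdX, hnE] at hslope
  set n₁ := finrank ℂ W with hn₁def
  set X₁ : Submodule ℤ (Fin n → ℂ) := X ⊓ W.restrictScalars ℤ with hX₁def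
  have hd₁ : finrank ℤ X₁ = rankInter ℂ X W := rfl
  set d₁ := rankInter ℂ X W with hd₁def
  -- `hslope : d * n₁ < d₁ * n`
  have hd₁pos : 0 < d₁ := (pos_of_mul_lt_mul hslope).1
  have hspanX₁ : Submodule.span ℂ (X₁ : Set (Fin n → ℂ)) = W :=
    span_inf_eq_of_slope_maximal hXfg hd₁pos hmax
  have hn₁' : finrank ℂ (Submodule.span ℂ (X₁ : Set (Fin n → ℂ))) = n₁ := by rw [hspanX₁]
  -- Step 3: `X₁` is a direct factor of `X`
  obtain ⟨X₂, hXsup, hXinf⟩ :=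
    exists_compl_of_saturated hXfg (inf_le_left : X₁ ≤ X) (saturated_inf_restrictScalars X W)
  -- Step 4: `V = W^⊥ = ker s`, `Y₂ = Y ∩ V` is a direct factor of `Y`
  let bW : Basis (Fin n₁) ℂ W := Module.finBasis ℂ W
  set w : Matrix (Fin n₁) (Fin n) ℂ := Matrix.of fun k => ((bW k : W) : Fin n → ℂ) with hwdef
  set s : (Fin n → ℂ) →ₗ[ℂ] (Fin n₁ → ℂ) := w.mulVecLin with hsdef
  set V : Submodule ℂ (Fin n → ℂ) := LinearMap.ker s with hVdef
  set Y₂ : Submodule ℤ (Fin n → ℂ) := Y ⊓ V.restrictScalars ℤ with hY₂def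
  obtain ⟨Y₁, hYsup, hYinf⟩ :=
    exists_compl_of_saturated hYfg (inf_le_left : Y₂ ≤ Y) (saturated_inf_restrictScalars Y V)
  have hY₁Y : Y₁ ≤ Y := hYsup ▸ le_sup_right
  have hX₁W : ∀ u ∈ X₁, u ∈ W := fun u hu => hu.2
  refine ⟨X₁, X₂, Y₁, Y₂, hXsup, hXinf, ?_, ?_, ?_, ?_, ?_⟩
  · rw [sup_comm]; exact hYsup
  · rw [inf_comm]; exact hYinf
  · -- `⟨X₁, Y₂⟩ = 0`
    intro u hu v hv
    have huW : u ∈ Submodule.span ℂ (Set.range w.row) := by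
      rw [hwdef, span_row_of_basis]; exact hX₁W u hu
    exact dotProduct_eq_zero_of_mem_ker w hv.2 huW
  · -- `d/n < d₁/n₁`
    rw [hn₁', hd₁]
    exact hslope
  · -- `ℓ₁ d₁ ≤ n₁ (ℓ₁ + d₁)`
    rw [hn₁', hd₁]
    set l₁ := finrank ℤ Y₁ with hl₁def
    rcases Nat.lt_or_ge n₁ l₁ with hlt | hle
    swap
    · -- trivial case `ℓ₁ ≤ n₁`
      calc l₁ * d₁ ≤ n₁ * d₁ := Nat.mul_le_mul_right _ hle
        _ ≤ n₁ * (l₁ + d₁) := Nat.mul_le_mul_left _ (Nat.le_add_left _ _)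
    · -- Proposition 6.1 in `W ≅ ℂ^{n₁}`
      have hn₁pos : 0 < n₁ := hWpos
      obtain ⟨P, hPinj, hPsurj, hPdot⟩ := exists_coordinates W bW
      -- `ℤ`-bases of `X₁` and `Y₁`
      haveI : Module.Finite ℤ X₁ := finite_inf_of_fg hXfg _
      haveI : Module.Finite ℤ Y := Module.Finite.iff_fg.mpr hYfg
      haveI : Module.Finite ℤ Y₁ :=
        Module.Finite.of_injective (Submodule.inclusion hY₁Y) (Submodule.inclusion_injective hY₁Y)
      let bX : Basis (Fin (finrank ℤ X₁)) ℤ X₁ := Module.finBasis ℤ X₁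
      let bY : Basis (Fin (finrank ℤ Y₁)) ℤ Y₁ := Module.finBasis ℤ Y₁
      -- the families `u = s ∘ bY`, `v = P ∘ bX` of `ℂ^{n₁}`
      let fX : X₁ →ₗ[ℤ] (Fin n₁ → ℂ) := (P.restrictScalars ℤ).domRestrict X₁
      let fY : Y₁ →ₗ[ℤ] (Fin n₁ → ℂ) := (s.restrictScalars ℤ).domRestrict Y₁
      have hfX : LinearMap.ker fX = ⊥ := by
        rw [LinearMap.ker_eq_bot]
        intro a b hab
        apply Subtype.ext
        have h0 : P ((a : Fin n → ℂ) - b) = 0 := by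
          have : P a = P b := hab
          rw [map_sub, this, sub_self]
        exact sub_eq_zero.mp (hPinj _ (W.sub_mem (hX₁W _ a.2) (hX₁W _ b.2)) h0)
      have hfY : LinearMap.ker fY = ⊥ := by
        rw [LinearMap.ker_eq_bot]
        intro a b hab
        apply Subtype.ext
        have h0 : s ((a : Fin n → ℂ) - b) = 0 := by
          have : s a = s b := hab
          rw [map_sub, this, sub_self]
        have hmemY₂ : (a : Fin n → ℂ) - b ∈ Y₂ := ⟨hY₁Y (Y₁.sub_mem a.2 b.2), h0⟩
        have hmem : (a : Fin n → ℂ) - b ∈ Y₂ ⊓ Y₁ := ⟨hmemY₂, Y₁.sub_mem a.2 b.2⟩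
        rw [hYinf, Submodule.mem_bot] at hmem
        exact sub_eq_zero.mp hmem
      let u : Fin (finrank ℤ Y₁) → Fin n₁ → ℂ := fun j => s (bY j : Fin n → ℂ)
      let v : Fin (finrank ℤ X₁) → Fin n₁ → ℂ := fun i => P (bX i : Fin n → ℂ)
      have hu : LinearIndependent ℤ u := bY.linearIndependent.map' fY hfY
      have hv : LinearIndependent ℤ v := bX.linearIndependent.map' fX hfX
      -- `exp (u j ⬝ v i) = exp ⟨bX i, bY j⟩` is algebraic
      have halg₁ : ∀ j i, IsAlgebraic ℚ (cexp (u j ⬝ᵥ v i)) := by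
        intro j i
        have h1 : u j ⬝ᵥ v i = (bX i : Fin n → ℂ) ⬝ᵥ (bY j : Fin n → ℂ) := by
          rw [dotProduct_comm]
          exact (hPdot _ (hX₁W _ (bX i).2) _).symm
        rw [h1]
        exact isAlgebraic_cexp_dotProduct_of_mem_span halg (bX i).2.1 (hY₁Y (bY j).2)
      -- Proposition 6.1 in `ℂ^{n₁}`: `μ(P X₁) ≤ ℓ₁/(ℓ₁ - n₁)`
      have hnW : finrank ℂ (Fin n₁ → ℂ) = n₁ := Module.finrank_fin_fun ℂ
      have h61' := h61 u v hu hv halg₁ (by exact hlt)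
      have hspanv : Submodule.span ℤ (Set.range v) = X₁.map (P.restrictScalars ℤ) := by
        have hrange : Set.range v = (P.restrictScalars ℤ) '' Set.range fun i => (bX i : Fin n → ℂ) := by
          rw [← Set.range_comp]; rfl
        rw [hrange, Submodule.span_image, span_range_coe_basis bX]
      rw [hspanv] at h61'
      -- slope maximality in coordinates: `μ(P X₁) ≥ d₁/n₁`
      have hnot := not_mu_map_lt_of_slope_maximal (K := ℂ) (X := X) rfl hn₁pos hmax P hPinj hPsurj
      have hle' : (d₁ : ℚ) / n₁ ≤ (l₁ : ℚ) / (l₁ - n₁) := le_trans (not_lt.mp hnot) h61'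
      exact mul_le_mul_add_of_div_le_div hn₁pos hlt hle'

/-- **Théorème 2.1 from Proposition 6.1**: the composite of `thm_1_1_of_prop_6_1` (§6 a)) with
the tree's `thm_2_1_of_thm_1_1` (§6 c)). [cite: Waldschmidt1981, §6 a), c) (pp. 109–111)] -/
theorem thm_2_1_of_prop_6_1 (h61 : prop_6_1) : thm_2_1 :=
  thm_2_1_of_thm_1_1 (thm_1_1_of_prop_6_1 h61)

end Literature.NumberTheory.Transcendental.Waldschmidt1981

end
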